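import Summits.Parity.BatemanHorn.Theorems.SoloInformedTwinUnbalancedSmallClass

/-!
# SoloInformedTwinUnbalancedSmall — the small-cofactor regime (1a): the sum over the cofactors

Solo unit `solo-Parity-informed` (ideation tier, informed mode), session 80; `paper.md` §20
(Theorem 20.1 = (F′), step (1a)), PLAN §60/§62.4 (file F3 of the kernel project F1–F5, second
half; first half = `SoloInformedTwinUnbalancedSmallClass`), CLAIMS C144.

`SoloInformedTwinUnbalancedSmallClass` bounds, for ONE cofactor `k` prime to `r₀`, the sum over
the moduli `q ≤ z` of the inner class sums `|innerP(q,k)|` of packaging P by Bombieri–Vinogradov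
for `μ` at a scale `X_k`.  Here the cofactors `k ≤ K` are summed with `X_k = hi/k`:
the regime (1a) is `K (2z (log X)^B)² ≤ hi` (every modulus `2z` is within the level
`X_k^{1/2}(log X_k)^{-B}`) and `K X^{1/2} ≤ hi` (so `log X_k ≥ ½ log X`); the harmonic sum
`∑_{k ≤ K} X_k ≤ hi (1 + log K)` and `(log(hi/k))^j ≤ (log X)^j` give

  `∑_{q ≤ z} |∑_{k ≤ K, (k,r₀)=1} innerP(q,k)| ≤ C X (log X)^{-A}`      (`sum_abs_innerP_small_le_of_bv`)

for every `A`, uniformly in `lo, hi ≤ X, y, z, K` — the (1a) half of (F′) for each of the four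
switched sums of `SoloInformedTwinUnbalancedSwitch` (families `r₀ = 1`, `a = ±1` and `r₀ = 2`,
`a = ±2`).  The only analytic input is Bombieri–Vinogradov for `μ` without main term over dilated
moduli, entered as the hypothesis `MoebiusBVDilate A'` = the statement of the PROVED tree theorem
`Literature.NumberTheory.Sieve.BVMoebius.sum_abs_moebiusAPSum_dilate_le A'`
(`BombieriVinogradovMoebiusIntervals.lean`); it is discharged by that theorem where the module is
imported (file F5).  No bilinear input.
-/

namespace Summit.Parity.BatemanHorn.Theorems

open Finset Real
open scoped ArithmeticFunction.Moebius
open Literature.NumberTheory.Sieve Literature.NumberTheory.Sieve.BVMoebius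

/-! ### 1. The Bombieri–Vinogradov input, as a statement -/

/-- Bombieri–Vinogradov for `μ` without main term over dilated moduli `k d`, saving `(log x)^{-A}`:
the statement of `BVMoebius.sum_abs_moebiusAPSum_dilate_le A` (PROVED in the tree). -/
def MoebiusBVDilate (A : ℝ) : Prop :=
  ∃ B C x₀ : ℝ, 0 < B ∧ 0 ≤ C ∧ ∀ x : ℝ, x₀ ≤ x → ∀ k : ℕ, 0 < k → ∀ 𝒟 : Finset ℕ,
    (∀ d ∈ 𝒟, 1 ≤ d ∧ ((k * d : ℕ) : ℝ) ≤ x ^ (1 / 2 : ℝ) / Real.log x ^ B) →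
    ∀ t : ℕ → ℕ, (∀ d, (t d : ℝ) ≤ x) → ∀ a : ℕ → ℕ, (∀ d ∈ 𝒟, (a d).Coprime (k * d)) →
      ∑ d ∈ 𝒟, |moebiusAPSum (t d) (k * d) ((a d : ℕ) : ZMod (k * d))|
        ≤ C * x / Real.log x ^ A

/-! ### 2. Elementary bookkeeping -/

/-- `log n ≤ log X` for a natural number `n ≤ X`, `X ≥ 1` (also for `n = 0`). -/
theorem log_natCast_le_log {n : ℕ} {X : ℝ} (hX : 1 ≤ X) (h : (n : ℝ) ≤ X) :
    Real.log n ≤ Real.log X := by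
  rcases Nat.eq_zero_or_pos n with rfl | hn
  · rw [Nat.cast_zero, Real.log_zero]
    exact Real.log_nonneg hX
  · exact Real.log_le_log (by exact_mod_cast hn) h

/-- `2 ≤ log X` for `X ≥ 9`. -/
theorem two_le_log_of_nine_le {X : ℝ} (hX : 9 ≤ X) : 2 ≤ Real.log X := by
  rw [Real.le_log_iff_exp_le (by linarith)]
  have h := Real.exp_one_lt_d9
  have h0 := Real.exp_pos 1
  have : Real.exp 2 < 9 := by
    calc Real.exp 2 = Real.exp 1 * Real.exp 1 := by rw [← Real.exp_add]; norm_num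
      _ < 2.7182818286 * 2.7182818286 := mul_lt_mul'' h h h0.le h0.le
      _ < 9 := by norm_num
  linarith

/-- `a = √(a²) ≤ √b` for `a ≥ 0`, `a² ≤ b`, with `√b = b^{1/2}`. -/
theorem le_rpow_half_of_sq_le {a b : ℝ} (ha : 0 ≤ a) (h : a ^ 2 ≤ b) : a ≤ b ^ (1 / 2 : ℝ) := by
  rw [← Real.sqrt_eq_rpow]
  calc a = Real.sqrt (a ^ 2) := (Real.sqrt_sq ha).symm
    _ ≤ Real.sqrt b := Real.sqrt_le_sqrt h

/-! ### 3. Regime (1a): the sum over the cofactors -/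

/-- **Regime (1a) of (F′)** (given Bombieri–Vinogradov for `μ`, `hBV`).  For the family `r₀ = 1`
(`a` prime to every modulus) or `r₀ = 2`, `2 ∣ a` (`a` prime to the odd moduli) and every `A > 0`
there are `B > 0`, `C ≥ 0`, `X₀` such that for `X ≥ X₀`, all `lo`, `hi ≤ X`, `y`, `z` and every
cofactor range `K` with `K (2z (log X)^B)² ≤ hi` and `K X^{1/2} ≤ hi`:
`∑_{q ≤ z} |∑_{k ≤ K} 𝟙[(k,r₀)=1] innerP(q,k)| ≤ C X (log X)^{-A}`. -/
theorem sum_abs_innerP_small_le_of_bv (hBV : ∀ A : ℝ, 0 < A → MoebiusBVDilate A) (j : ℕ)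
    {r₀ : ℕ} {a : ℤ} (hfam : r₀ = 1 ∨ (r₀ = 2 ∧ (2 : ℤ) ∣ a))
    (ha : ∀ q : ℕ, q.Coprime r₀ → IsCoprime (q : ℤ) a) (A : ℝ) (hA : 0 < A) :
    ∃ B C X₀ : ℝ, 0 < B ∧ 0 ≤ C ∧ ∀ X : ℝ, X₀ ≤ X → ∀ lo hi y z K : ℕ, (hi : ℝ) ≤ X →
      (K : ℝ) * (2 * z * Real.log X ^ B) ^ 2 ≤ hi → (K : ℝ) * X ^ (1 / 2 : ℝ) ≤ hi →
      ∑ q ∈ Icc 1 z, |∑ k ∈ Icc 1 K,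
          (if k.Coprime r₀ then (1 : ℝ) else 0) * innerP j r₀ lo hi y a q k|
        ≤ C * X / Real.log X ^ A := by
  set A' : ℝ := A + (j + 1) with hA'
  have hA'0 : 0 < A' := by positivity
  obtain ⟨B, C, x₀, hB, hC, hbv⟩ := hBV A' hA'0
  set X₁ : ℝ := max x₀ 3 with hX₁
  have hX₁3 : (3 : ℝ) ≤ X₁ := le_max_right _ _
  have hX₁0 : (0 : ℝ) ≤ X₁ := by linarith
  have h2A' : (0 : ℝ) < 2 ^ A' := Real.rpow_pos_of_pos two_pos _
  refine ⟨B, 2 ^ (j + 2) * 2 ^ A' * C, X₁ ^ 2, hB, by positivity, ?_⟩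
  intro X hX lo hi y z K hhi hK1 hK2
  -- facts about `X` and `L = log X`
  have hX9 : (9 : ℝ) ≤ X := by
    have : (3 : ℝ) ^ 2 ≤ X₁ ^ 2 := pow_le_pow_left₀ (by norm_num) hX₁3 2
    linarith
  have hX0 : 0 < X := by linarith
  have hX1 : 1 ≤ X := by linarith
  have hsqrt : X₁ ≤ X ^ (1 / 2 : ℝ) := le_rpow_half_of_sq_le hX₁0 hX
  have hx₀X : x₀ ≤ X ^ (1 / 2 : ℝ) := le_trans (le_max_left _ _) hsqrt
  have h3X : 3 ≤ X ^ (1 / 2 : ℝ) := le_trans hX₁3 hsqrt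
  set L := Real.log X with hLdef
  have hL2 : 2 ≤ L := two_le_log_of_nine_le hX9
  have hL0 : 0 < L := by linarith
  have hL1 : 1 ≤ L := by linarith
  have hLA' : 0 < L ^ A' := Real.rpow_pos_of_pos hL0 _
  have hLA : 0 < L ^ A := Real.rpow_pos_of_pos hL0 _
  have hLB : 0 ≤ L ^ B := (Real.rpow_pos_of_pos hL0 _).le
  -- `K ≤ hi ≤ X`
  have hKhi : (K : ℝ) ≤ hi := by
    have : (K : ℝ) * 1 ≤ (K : ℝ) * X ^ (1 / 2 : ℝ) :=
      mul_le_mul_of_nonneg_left (by linarith) (Nat.cast_nonneg K)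
    linarith
  have hKX : (K : ℝ) ≤ X := hKhi.trans hhi
  -- the per-cofactor bound `𝟙[(k,r₀)=1] ∑_q |innerP(q,k)| ≤ M₀ / k`
  set M₀ : ℝ := 2 ^ (j + 1) * L ^ j * (C * 2 ^ A' * (hi : ℝ) / L ^ A') with hM₀
  have hM₀0 : 0 ≤ M₀ :=
    mul_nonneg (mul_nonneg (by positivity) (pow_nonneg hL0.le j))
      (div_nonneg (mul_nonneg (mul_nonneg hC h2A'.le) (Nat.cast_nonneg hi)) hLA'.le)
  have hper : ∀ k ∈ Icc 1 K,
      (if k.Coprime r₀ then (1 : ℝ) else 0) * ∑ q ∈ Icc 1 z, |innerP j r₀ lo hi y a q k|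
        ≤ M₀ * (1 / k) := by
    intro k hk
    rw [mem_Icc] at hk
    have hk0 : (0 : ℝ) < k := by exact_mod_cast hk.1
    have hkK : (k : ℝ) ≤ K := by exact_mod_cast hk.2
    by_cases hkr : k.Coprime r₀
    · rw [if_pos hkr, one_mul]
      set Xk : ℝ := (hi : ℝ) / k with hXk
      have hXk_ge : X ^ (1 / 2 : ℝ) ≤ Xk := by
        rw [hXk, le_div_iff₀ hk0]
        calc X ^ (1 / 2 : ℝ) * k ≤ X ^ (1 / 2 : ℝ) * K :=
              mul_le_mul_of_nonneg_left hkK (by positivity)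
          _ = (K : ℝ) * X ^ (1 / 2 : ℝ) := mul_comm _ _
          _ ≤ hi := hK2
      have hXk3 : 3 ≤ Xk := h3X.trans hXk_ge
      have hXk0 : 0 < Xk := by linarith
      have hXk_le : Xk ≤ X := by
        rw [hXk]
        exact (div_le_self (Nat.cast_nonneg hi) (by exact_mod_cast hk.1)).trans hhi
      have hx₀k : x₀ ≤ Xk := hx₀X.trans hXk_ge
      have hhik : ((hi / k : ℕ) : ℝ) ≤ Xk := Nat.cast_div_le
      -- logarithms of `X_k`
      have hlogk_le : Real.log Xk ≤ L := Real.log_le_log hXk0 hXk_le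
      have hlogk_ge : L / 2 ≤ Real.log Xk := by
        have h1 : Real.log (X ^ (1 / 2 : ℝ)) ≤ Real.log Xk :=
          Real.log_le_log (by positivity) hXk_ge
        rw [Real.log_rpow hX0] at h1
        linarith
      have hlogk0 : 0 < Real.log Xk := by linarith
      have hLkA' : 0 < Real.log Xk ^ A' := Real.rpow_pos_of_pos hlogk0 _
      -- the level `2z ≤ X_k^{1/2} (log X_k)^{-B}`
      have hlev : (2 * z : ℝ) ≤ Xk ^ (1 / 2 : ℝ) / Real.log Xk ^ B := by
        have hLkB : 0 < Real.log Xk ^ B := Real.rpow_pos_of_pos hlogk0 _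
        have hLkB_le : Real.log Xk ^ B ≤ L ^ B := Real.rpow_le_rpow hlogk0.le hlogk_le hB.le
        rw [le_div_iff₀ hLkB]
        have hsq : (2 * z * L ^ B) ^ 2 ≤ Xk := by
          rw [hXk, le_div_iff₀ hk0]
          calc (2 * z * L ^ B) ^ 2 * k ≤ (2 * z * L ^ B) ^ 2 * K :=
                mul_le_mul_of_nonneg_left hkK (sq_nonneg _)
            _ = (K : ℝ) * (2 * z * L ^ B) ^ 2 := mul_comm _ _
            _ ≤ hi := hK1
        calc (2 * z : ℝ) * Real.log Xk ^ B ≤ 2 * z * L ^ B :=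
              mul_le_mul_of_nonneg_left hLkB_le (by positivity)
          _ ≤ Xk ^ (1 / 2 : ℝ) := le_rpow_half_of_sq_le (by positivity) hsq
      -- the one-cofactor lemma and the comparison of the factors
      have h1 := sum_abs_innerP_le_of_bv hbv hfam ha hkr j lo hi y z hx₀k hhik hlev
      have hlogB : Real.log ((hi / k : ℕ) : ℝ) ^ j ≤ L ^ j :=
        pow_le_pow_left₀ (Real.log_natCast_nonneg _)
          (log_natCast_le_log hX1 (hhik.trans hXk_le)) j
      have hmain : C * Xk / Real.log Xk ^ A' ≤ C * 2 ^ A' * Xk / L ^ A' := by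
        have hpow : L ^ A' / 2 ^ A' ≤ Real.log Xk ^ A' := by
          rw [← Real.div_rpow hL0.le (by norm_num : (0 : ℝ) ≤ 2)]
          exact Real.rpow_le_rpow (by positivity) hlogk_ge hA'0.le
        have hpos : 0 < L ^ A' / 2 ^ A' := div_pos hLA' h2A'
        calc C * Xk / Real.log Xk ^ A' ≤ C * Xk / (L ^ A' / 2 ^ A') :=
              div_le_div_of_nonneg_left (mul_nonneg hC hXk0.le) hpos hpow
          _ = C * 2 ^ A' * Xk / L ^ A' := by
              field_simp
      calc ∑ q ∈ Icc 1 z, |innerP j r₀ lo hi y a q k|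
          ≤ 2 ^ (j + 1) * Real.log ((hi / k : ℕ) : ℝ) ^ j * (C * Xk / Real.log Xk ^ A') := h1
        _ ≤ 2 ^ (j + 1) * L ^ j * (C * 2 ^ A' * Xk / L ^ A') :=
            mul_le_mul (mul_le_mul_of_nonneg_left hlogB (by positivity)) hmain
              (div_nonneg (mul_nonneg hC hXk0.le) hLkA'.le)
              (mul_nonneg (by positivity) (pow_nonneg hL0.le j))
        _ = M₀ * (1 / k) := by
            rw [hM₀, hXk]
            ring
    · rw [if_neg hkr, zero_mul]
      exact mul_nonneg hM₀0 (by positivity)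
  -- the sum over the cofactors
  have hind_abs : ∀ q k, |(if k.Coprime r₀ then (1 : ℝ) else 0) * innerP j r₀ lo hi y a q k|
      = (if k.Coprime r₀ then (1 : ℝ) else 0) * |innerP j r₀ lo hi y a q k| := by
    intro q k
    split_ifs <;> simp
  have hLsplit : L ^ A' = L ^ A * L ^ (j + 1) := by
    rw [hA', Real.rpow_add hL0, ← Nat.cast_succ, Real.rpow_natCast]
  calc ∑ q ∈ Icc 1 z, |∑ k ∈ Icc 1 K,
          (if k.Coprime r₀ then (1 : ℝ) else 0) * innerP j r₀ lo hi y a q k|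
      ≤ ∑ q ∈ Icc 1 z, ∑ k ∈ Icc 1 K,
          (if k.Coprime r₀ then (1 : ℝ) else 0) * |innerP j r₀ lo hi y a q k| := by
        refine sum_le_sum fun q _ => (abs_sum_le_sum_abs _ _).trans_eq ?_
        exact sum_congr rfl fun k _ => hind_abs q k
    _ = ∑ k ∈ Icc 1 K, (if k.Coprime r₀ then (1 : ℝ) else 0) *
          ∑ q ∈ Icc 1 z, |innerP j r₀ lo hi y a q k| := by
        rw [sum_comm]
        exact sum_congr rfl fun k _ => by rw [mul_sum]
    _ ≤ ∑ k ∈ Icc 1 K, M₀ * (1 / k) := sum_le_sum hper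
    _ = M₀ * ∑ k ∈ Icc 1 K, (1 : ℝ) / k := by rw [mul_sum]
    _ ≤ M₀ * (2 * L) := by
        refine mul_le_mul_of_nonneg_left ?_ hM₀0
        -- the harmonic sum `∑_{k ≤ K} 1/k ≤ 1 + log K` (Mathlib's `harmonic_le_one_add_log`;
        -- the tree's `FriedlanderIwaniecPrimes.sum_Icc_one_div_le`)
        have hharm : ∑ k ∈ Icc 1 K, (1 : ℝ) / k ≤ 1 + Real.log K := by
          have h := harmonic_le_one_add_log K
          rw [harmonic_eq_sum_Icc] at h
          push_cast at h
          simpa only [one_div] using h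
        calc ∑ k ∈ Icc 1 K, (1 : ℝ) / k ≤ 1 + Real.log K := hharm
          _ ≤ 1 + L := by linarith [log_natCast_le_log hX1 hKX]
          _ ≤ 2 * L := by linarith
    _ = 2 ^ (j + 2) * 2 ^ A' * C * (hi : ℝ) / L ^ A := by
        rw [hM₀, hLsplit]
        field_simp
        ring
    _ ≤ 2 ^ (j + 2) * 2 ^ A' * C * X / L ^ A := by
        refine div_le_div_of_nonneg_right ?_ hLA.le
        exact mul_le_mul_of_nonneg_left hhi (by positivity)

end Summit.Parity.BatemanHorn.Theorems
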